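import Summits.CriticalPhenomena.PercolationContinuityZ3.Theorems.PercNearOneGluingNoHeavyLowerTailKnQuestion8CoefficientwiseRootPointFlip
import HarnessLib

/-!
# The HALF point row at a root of degree two, I: the SECTOR IDENTITY for `Σ_W σ_u Δg` (prim-lf-2 gen 42)

Support file (`--supports stmt-CriticalPhenomena-4575`, closed), prover `prim-lf-2` (gen 42).  No definitions, no named facts, no sorries; standard axioms.
Memo `prim-lf-2/CW-ROOTFLIP-gen42.md` §1.3; companion of `…CoefficientwiseRootPointFlip` (THEOREM R42, the point entries `g = 1_w`) whose blue-cluster flip it reuses.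

Setting (CW-POINTS-gen32, CW-LOCALITY-gen33): multigraph `ends : ι → Sym2 V` on an edge set `E`, root `x`, wall set `Z ∌ x`, colourings `s ⊔ (E∖s)`, red / blue clusters
`C_x(s)`, `C_x(E∖s)`, `σ_u = 1[u ∈ C_x s] − 1[u ∈ C_x(E∖s)]`, `Δg = g(C_x s) − g(C_x(E∖s))`.  The HALF POINT ROW (the row `f = 1_u` of CW-PA) is the conjecture
`0 ≤ Σ_{W_E} σ_u Δg` for every monotone `g : Set V → ℝ` (gen 33; proved there when `|N(z) ∖ {u,w}| ≤ 1`).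

* `Coefficientwise.openCluster_eq_singleton_of_rootless`, `Coefficientwise.openCluster_insert_rootEdge_eq`, `Coefficientwise.openCluster_insert_two_rootEdges_eq` — the
  gen-38 membership lemmas as SET equalities (`C_x(t) = {x}`, `C_x(t ∪ e₁) = {x} ∪ C_p t`, `C_x(t ∪ e₁ ∪ e₂) = {x} ∪ C_p t ∪ C_q t` for `t` avoiding `x`).
* `Coefficientwise.halfRow_rootDegTwo_eq` — SECTOR IDENTITY for the half row at a simple degree-two root `N(x) = {p,q}`:
  `Σ_{W_E} σ_u Δg = 2·Σ_{t ⊆ E', Z ∩ (C_p t ∪ C_q t) = ∅} 1[u ∈ C_p t ∪ C_q t]·(g({x} ∪ C_p t ∪ C_q t) − g{x})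
                 + 2·Σ_{t ⊆ E', Z ∩ C_p t = ∅ = Z ∩ C_q(E'∖t)} (1[u ∈ C_p t] − 1[u ∈ C_q(E'∖t)])·(g({x} ∪ C_p t) − g({x} ∪ C_q(E'∖t)))`.
The companion file `…CoefficientwiseRootPointFlipHalf` deduces THEOREM R42-HALF (`0 ≤ Σ_W σ_u Δg` for every monotone `g` when `p = u`) from this identity and the
blue-cluster flip of `…CoefficientwiseRootPointFlip`.
[cite: KozmaNitzan2024, Questions 8–9 (§5.5 p. 36) (context: the Question-8 pocket covariance programme; the argument is an elementary injection)]
-/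

namespace Summit.CriticalPhenomena.PercolationContinuityZ3.Theorems

open Finset Literature.Probability.Percolation
open scoped symmDiff

namespace Coefficientwise

variable {ι V : Type*} (ends : ι → Sym2 V)

section sets

variable [DecidableEq ι]

omit [DecidableEq ι] in
/-- `C_x(t) = {x}` when no edge of `t` contains `x`. [cite: KozmaNitzan2024, §5.5 (context only; folklore)] -/
theorem openCluster_eq_singleton_of_rootless {t : Finset ι} {x : V} (ht : ∀ i ∈ t, x ∉ ends i) :
    openCluster (ends '' (↑t : Set ι)) x = ({x} : Set V) := by
  ext v
  rw [mem_openCluster_iff_eq_of_rootless ends ht, Set.mem_singleton_iff]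

/-- `C_x(t ∪ {e}) = {x} ∪ C_p(t)` for a root edge `e = {x,p}` and `t` avoiding `x`. [cite: KozmaNitzan2024, §5.5 (context only; folklore)] -/
theorem openCluster_insert_rootEdge_eq {t : Finset ι} {x p : V} {e : ι} (he : ends e = s(x, p))
    (ht : ∀ i ∈ t, x ∉ ends i) :
    openCluster (ends '' (↑(insert e t) : Set ι)) x = insert x (openCluster (ends '' (↑t : Set ι)) p) := by
  ext v
  rw [mem_openCluster_insert_rootEdge_iff ends he ht, Set.mem_insert_iff]

/-- `C_x(t ∪ {e₁, e₂}) = {x} ∪ C_p(t) ∪ C_q(t)` for root edges `e₁ = {x,p}`, `e₂ = {x,q}` and `t` avoiding `x`. [cite: KozmaNitzan2024, §5.5 (context only; folklore)] -/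
theorem openCluster_insert_two_rootEdges_eq {t : Finset ι} {x p q : V} {e₁ e₂ : ι} (h₁ : ends e₁ = s(x, p)) (h₂ : ends e₂ = s(x, q))
    (ht : ∀ i ∈ t, x ∉ ends i) :
    openCluster (ends '' (↑(insert e₁ (insert e₂ t)) : Set ι)) x =
      insert x (openCluster (ends '' (↑t : Set ι)) p ∪ openCluster (ends '' (↑t : Set ι)) q) := by
  ext v
  rw [mem_openCluster_insert_two_rootEdges_iff ends h₁ h₂ ht, Set.mem_insert_iff, Set.mem_union]

end sets

section sums

variable [DecidableEq ι]

open Classical in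
/-- **SECTOR IDENTITY FOR THE HALF ROW AT A ROOT OF DEGREE TWO.**  Let the only edges of `E` at `x` be `e₁ ≠ e₂` with ends `{x,p}`, `{x,q}`, `E' = (E.erase e₁).erase e₂`,
`u ≠ x`, `x ∉ Z`, `g : Set V → ℝ` arbitrary.  Then `Σ_{W_E} σ_u Δg = 2·PURE + 2·MIXED` with
`PURE = Σ_{t ⊆ E' : Z ∩ (C_p t ∪ C_q t) = ∅} 1[u ∈ C_p t ∪ C_q t]·(g({x} ∪ C_p t ∪ C_q t) − g {x})` and
`MIXED = Σ_{t ⊆ E' : Z ∩ C_p t = ∅ = Z ∩ C_q(E'∖t)} (1[u ∈ C_p t] − 1[u ∈ C_q(E'∖t)])·(g({x} ∪ C_p t) − g({x} ∪ C_q(E'∖t)))`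
(the two pure and the two mixed sectors are identified by the colour swap `t ↦ E' ∖ t`).  [cite: KozmaNitzan2024, Questions 8–9 (§5.5 p. 36) (context)] -/
theorem halfRow_rootDegTwo_eq (E : Finset ι) {x p q : V} {e₁ e₂ : ι} (he₁ : e₁ ∈ E) (he₂ : e₂ ∈ E) (hne : e₁ ≠ e₂)
    (h₁ : ends e₁ = s(x, p)) (h₂ : ends e₂ = s(x, q)) (hroot : ∀ i ∈ E, x ∈ ends i → i = e₁ ∨ i = e₂)
    (u : V) (hux : u ≠ x) (Z : Set V) (hxZ : x ∉ Z) (g : Set V → ℝ) :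
    ∑ s ∈ E.powerset.filter (fun s : Finset ι => ∀ z ∈ Z, z ∉ openCluster (ends '' (↑(s) : Set ι)) x ∧ z ∉ openCluster (ends '' (↑(E \ s) : Set ι)) x),
      ((if u ∈ openCluster (ends '' (↑(s) : Set ι)) x then (1 : ℝ) else 0) - (if u ∈ openCluster (ends '' (↑(E \ s) : Set ι)) x then (1 : ℝ) else 0)) *
        (g (openCluster (ends '' (↑(s) : Set ι)) x) - g (openCluster (ends '' (↑(E \ s) : Set ι)) x)) =
    2 * (∑ t ∈ ((E.erase e₁).erase e₂).powerset.filter (fun t : Finset ι => ∀ z ∈ Z,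
          z ∉ openCluster (ends '' (↑(t) : Set ι)) p ∧ z ∉ openCluster (ends '' (↑(t) : Set ι)) q),
      (if (u ∈ openCluster (ends '' (↑(t) : Set ι)) p ∨ u ∈ openCluster (ends '' (↑(t) : Set ι)) q) then (1 : ℝ) else 0) *
        (g (insert x (openCluster (ends '' (↑(t) : Set ι)) p ∪ openCluster (ends '' (↑(t) : Set ι)) q)) - g {x})) +
    2 * (∑ t ∈ ((E.erase e₁).erase e₂).powerset.filter (fun t : Finset ι => ∀ z ∈ Z,
          z ∉ openCluster (ends '' (↑(t) : Set ι)) p ∧ z ∉ openCluster (ends '' (↑(((E.erase e₁).erase e₂) \ t) : Set ι)) q),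
      ((if u ∈ openCluster (ends '' (↑(t) : Set ι)) p then (1 : ℝ) else 0) -
          (if u ∈ openCluster (ends '' (↑(((E.erase e₁).erase e₂) \ t) : Set ι)) q then (1 : ℝ) else 0)) *
        (g (insert x (openCluster (ends '' (↑(t) : Set ι)) p)) - g (insert x (openCluster (ends '' (↑(((E.erase e₁).erase e₂) \ t) : Set ι)) q)))) := by
  set E' : Finset ι := (E.erase e₁).erase e₂ with hE'
  have he₁E' : e₁ ∉ E' := fun h => Finset.notMem_erase e₁ E (Finset.mem_of_mem_erase h)
  have he₂E' : e₂ ∉ E' := Finset.notMem_erase e₂ _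
  have he₁E'' : e₁ ∉ insert e₂ E' := by rw [Finset.mem_insert]; rintro (h | h); exacts [hne h, he₁E' h]
  have hE : E = insert e₁ (insert e₂ E') := by
    rw [hE', Finset.insert_erase (Finset.mem_erase.mpr ⟨fun h => hne h.symm, he₂⟩), Finset.insert_erase he₁]
  have hE'x : ∀ i ∈ E', x ∉ ends i := by
    intro i hi hxi
    have hiE : i ∈ E := Finset.mem_of_mem_erase (Finset.mem_of_mem_erase hi)
    rcases hroot i hiE hxi with hi1 | hi2
    · exact he₁E' (hi1 ▸ hi)
    · exact he₂E' (hi2 ▸ hi)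
  have htx : ∀ t : Finset ι, t ⊆ E' → ∀ i ∈ t, x ∉ ends i := fun t ht i hi => hE'x i (ht hi)
  have hsd : ∀ t : Finset ι, E' \ t ⊆ E' := fun t => Finset.sdiff_subset
  have hZx : ∀ z ∈ Z, z ≠ x := fun z hz hzx => hxZ (hzx ▸ hz)
  -- complements inside `E = insert e₁ (insert e₂ E')`
  have cRR : ∀ t, t ⊆ E' → (insert e₁ (insert e₂ E')) \ (insert e₁ (insert e₂ t)) = E' \ t := by
    intro t ht; ext i
    simp only [Finset.mem_sdiff, Finset.mem_insert, not_or]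
    constructor
    · rintro ⟨h1, h2, h3, h4⟩
      rcases h1 with h1 | h1 | h1
      · exact absurd h1 h2
      · exact absurd h1 h3
      · exact ⟨h1, h4⟩
    · rintro ⟨h1, h2⟩
      exact ⟨Or.inr (Or.inr h1), fun h => he₁E' (h ▸ h1), fun h => he₂E' (h ▸ h1), h2⟩
  have cBB : ∀ t, t ⊆ E' → (insert e₁ (insert e₂ E')) \ t = insert e₁ (insert e₂ (E' \ t)) := by
    intro t ht; ext i
    simp only [Finset.mem_sdiff, Finset.mem_insert]
    constructor
    · rintro ⟨h1, h2⟩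
      rcases h1 with h1 | h1 | h1
      · exact Or.inl h1
      · exact Or.inr (Or.inl h1)
      · exact Or.inr (Or.inr ⟨h1, h2⟩)
    · rintro (h1 | h1 | ⟨h1, h2⟩)
      · exact ⟨Or.inl h1, fun h => he₁E' (ht (h1 ▸ h))⟩
      · exact ⟨Or.inr (Or.inl h1), fun h => he₂E' (ht (h1 ▸ h))⟩
      · exact ⟨Or.inr (Or.inr h1), h2⟩
  have cRB : ∀ t, t ⊆ E' → (insert e₁ (insert e₂ E')) \ (insert e₁ t) = insert e₂ (E' \ t) := by
    intro t ht; ext i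
    simp only [Finset.mem_sdiff, Finset.mem_insert, not_or]
    constructor
    · rintro ⟨h1, h2, h3⟩
      rcases h1 with h1 | h1 | h1
      · exact absurd h1 h2
      · exact Or.inl h1
      · exact Or.inr ⟨h1, h3⟩
    · rintro (h1 | ⟨h1, h2⟩)
      · exact ⟨Or.inr (Or.inl h1), fun h => hne (h.symm.trans h1), fun h => he₂E' (ht (h1 ▸ h))⟩
      · exact ⟨Or.inr (Or.inr h1), fun h => he₁E' (h ▸ h1), h2⟩
  have cBR : ∀ t, t ⊆ E' → (insert e₁ (insert e₂ E')) \ (insert e₂ t) = insert e₁ (E' \ t) := by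
    intro t ht; ext i
    simp only [Finset.mem_sdiff, Finset.mem_insert, not_or]
    constructor
    · rintro ⟨h1, h2, h3⟩
      rcases h1 with h1 | h1 | h1
      · exact Or.inl h1
      · exact absurd h1 h2
      · exact Or.inr ⟨h1, h3⟩
    · rintro (h1 | ⟨h1, h2⟩)
      · exact ⟨Or.inl h1, fun h => hne (h1.symm.trans h), fun h => he₁E' (ht (h1 ▸ h))⟩
      · exact ⟨Or.inr (Or.inr h1), fun h => he₂E' (h ▸ h1), h2⟩
  -- the clusters in the four sectors, as sets
  have KRR : ∀ t, t ⊆ E' → openCluster (ends '' (↑(insert e₁ (insert e₂ t)) : Set ι)) x =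
      insert x (openCluster (ends '' (↑t : Set ι)) p ∪ openCluster (ends '' (↑t : Set ι)) q) :=
    fun t ht => openCluster_insert_two_rootEdges_eq ends h₁ h₂ (htx t ht)
  have K0 : ∀ t, t ⊆ E' → openCluster (ends '' (↑t : Set ι)) x = ({x} : Set V) :=
    fun t ht => openCluster_eq_singleton_of_rootless ends (htx t ht)
  have KR : ∀ t, t ⊆ E' → openCluster (ends '' (↑(insert e₁ t) : Set ι)) x = insert x (openCluster (ends '' (↑t : Set ι)) p) :=
    fun t ht => openCluster_insert_rootEdge_eq ends h₁ (htx t ht)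
  have KB : ∀ t, t ⊆ E' → openCluster (ends '' (↑(insert e₂ t) : Set ι)) x = insert x (openCluster (ends '' (↑t : Set ι)) q) :=
    fun t ht => openCluster_insert_rootEdge_eq ends h₂ (htx t ht)
  -- membership in the sector sets, for vertices other than `x`
  have mIns : ∀ (S : Set V) (v : V), v ≠ x → (v ∈ insert x S ↔ v ∈ S) := by
    intro S v hv; rw [Set.mem_insert_iff]; exact ⟨fun h => h.resolve_left hv, fun h => Or.inr h⟩
  have m0 : ∀ (v : V), v ≠ x → ¬ v ∈ ({x} : Set V) := fun v hv h => hv (Set.mem_singleton_iff.mp h)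
  -- the two target summands
  set fRR : Finset ι → ℝ := fun t => (if (∀ z ∈ Z, z ∉ openCluster (ends '' (↑(t) : Set ι)) p ∧ z ∉ openCluster (ends '' (↑(t) : Set ι)) q) then
      (if (u ∈ openCluster (ends '' (↑(t) : Set ι)) p ∨ u ∈ openCluster (ends '' (↑(t) : Set ι)) q) then (1 : ℝ) else 0) *
        (g (insert x (openCluster (ends '' (↑(t) : Set ι)) p ∪ openCluster (ends '' (↑(t) : Set ι)) q)) - g {x}) else 0) with hfRR
  set fRB : Finset ι → ℝ := fun t => (if (∀ z ∈ Z, z ∉ openCluster (ends '' (↑(t) : Set ι)) p ∧ z ∉ openCluster (ends '' (↑(E' \ t) : Set ι)) q) then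
      ((if u ∈ openCluster (ends '' (↑(t) : Set ι)) p then (1 : ℝ) else 0) - (if u ∈ openCluster (ends '' (↑(E' \ t) : Set ι)) q then (1 : ℝ) else 0)) *
        (g (insert x (openCluster (ends '' (↑(t) : Set ι)) p)) - g (insert x (openCluster (ends '' (↑(E' \ t) : Set ι)) q))) else 0) with hfRB
  have indT : ∀ (P Q : Prop), (P ↔ Q) → (if P then (1 : ℝ) else 0) = (if Q then (1 : ℝ) else 0) :=
    fun P Q h => if_congr h rfl rfl
  have ind0 : ∀ (P : Prop), ¬ P → (if P then (1 : ℝ) else 0) = 0 := fun P hP => if_neg hP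
  -- rewrite the left-hand side as a sum over `t ⊆ E'` of the four sector summands
  rw [Finset.sum_filter, hE, Finset.sum_powerset_insert he₁E'', Finset.sum_powerset_insert he₂E',
    Finset.sum_powerset_insert he₂E']
  -- sector BB (`s = t`)
  have sBB : ∀ t ∈ E'.powerset, (if (∀ z ∈ Z, z ∉ openCluster (ends '' (↑(t) : Set ι)) x ∧ z ∉ openCluster (ends '' (↑(insert e₁ (insert e₂ E') \ t) : Set ι)) x) then
      ((if u ∈ openCluster (ends '' (↑(t) : Set ι)) x then (1 : ℝ) else 0) - (if u ∈ openCluster (ends '' (↑(insert e₁ (insert e₂ E') \ t) : Set ι)) x then (1 : ℝ) else 0)) *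
        (g (openCluster (ends '' (↑(t) : Set ι)) x) - g (openCluster (ends '' (↑(insert e₁ (insert e₂ E') \ t) : Set ι)) x)) else 0) = fRR (E' \ t) := by
    intro t ht
    have htE : t ⊆ E' := Finset.mem_powerset.mp ht
    rw [cBB t htE, K0 t htE, KRR (E' \ t) (hsd t), hfRR]
    dsimp only
    have hwall : (∀ z ∈ Z, z ∉ ({x} : Set V) ∧ z ∉ insert x (openCluster (ends '' (↑(E' \ t) : Set ι)) p ∪ openCluster (ends '' (↑(E' \ t) : Set ι)) q)) ↔
        (∀ z ∈ Z, z ∉ openCluster (ends '' (↑(E' \ t) : Set ι)) p ∧ z ∉ openCluster (ends '' (↑(E' \ t) : Set ι)) q) := by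
      constructor
      · intro h z hz
        have h2 := (h z hz).2
        rw [mIns _ z (hZx z hz), Set.mem_union] at h2
        exact ⟨fun h' => h2 (Or.inl h'), fun h' => h2 (Or.inr h')⟩
      · intro h z hz
        refine ⟨m0 z (hZx z hz), fun h' => ?_⟩
        rw [mIns _ z (hZx z hz), Set.mem_union] at h'
        exact h'.elim (h z hz).1 (h z hz).2
    by_cases hW : ∀ z ∈ Z, z ∉ openCluster (ends '' (↑(E' \ t) : Set ι)) p ∧ z ∉ openCluster (ends '' (↑(E' \ t) : Set ι)) q
    · have hu : (u ∈ insert x (openCluster (ends '' (↑(E' \ t) : Set ι)) p ∪ openCluster (ends '' (↑(E' \ t) : Set ι)) q)) ↔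
          (u ∈ openCluster (ends '' (↑(E' \ t) : Set ι)) p ∨ u ∈ openCluster (ends '' (↑(E' \ t) : Set ι)) q) := by
        rw [mIns _ u hux, Set.mem_union]
      rw [if_pos (hwall.mpr hW), if_pos hW, ind0 _ (m0 u hux), indT _ _ hu]
      ring
    · rw [if_neg (fun h => hW (hwall.mp h)), if_neg hW]
  -- sector BR (`s = insert e₂ t`)
  have sBR : ∀ t ∈ E'.powerset, (if (∀ z ∈ Z, z ∉ openCluster (ends '' (↑(insert e₂ t) : Set ι)) x ∧ z ∉ openCluster (ends '' (↑(insert e₁ (insert e₂ E') \ (insert e₂ t)) : Set ι)) x) then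
      ((if u ∈ openCluster (ends '' (↑(insert e₂ t) : Set ι)) x then (1 : ℝ) else 0) - (if u ∈ openCluster (ends '' (↑(insert e₁ (insert e₂ E') \ (insert e₂ t)) : Set ι)) x then (1 : ℝ) else 0)) *
        (g (openCluster (ends '' (↑(insert e₂ t) : Set ι)) x) - g (openCluster (ends '' (↑(insert e₁ (insert e₂ E') \ (insert e₂ t)) : Set ι)) x)) else 0) = fRB (E' \ t) := by
    intro t ht
    have htE : t ⊆ E' := Finset.mem_powerset.mp ht
    have hss : E' \ (E' \ t) = t := Finset.sdiff_sdiff_eq_self htE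
    rw [cBR t htE, KB t htE, KR (E' \ t) (hsd t), hfRB]
    dsimp only
    rw [hss]
    have hwall : (∀ z ∈ Z, z ∉ insert x (openCluster (ends '' (↑t : Set ι)) q) ∧ z ∉ insert x (openCluster (ends '' (↑(E' \ t) : Set ι)) p)) ↔
        (∀ z ∈ Z, z ∉ openCluster (ends '' (↑(E' \ t) : Set ι)) p ∧ z ∉ openCluster (ends '' (↑(t) : Set ι)) q) := by
      constructor
      · intro h z hz
        obtain ⟨ha, hb⟩ := h z hz
        rw [mIns _ z (hZx z hz)] at ha hb
        exact ⟨hb, ha⟩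
      · intro h z hz
        obtain ⟨ha, hb⟩ := h z hz
        rw [mIns _ z (hZx z hz), mIns _ z (hZx z hz)]
        exact ⟨hb, ha⟩
    by_cases hW : ∀ z ∈ Z, z ∉ openCluster (ends '' (↑(E' \ t) : Set ι)) p ∧ z ∉ openCluster (ends '' (↑(t) : Set ι)) q
    · rw [if_pos (hwall.mpr hW), if_pos hW, indT _ _ (mIns _ u hux), indT _ _ (mIns _ u hux)]
      ring
    · rw [if_neg (fun h => hW (hwall.mp h)), if_neg hW]
  -- sector RB (`s = insert e₁ t`)
  have sRB : ∀ t ∈ E'.powerset, (if (∀ z ∈ Z, z ∉ openCluster (ends '' (↑(insert e₁ t) : Set ι)) x ∧ z ∉ openCluster (ends '' (↑(insert e₁ (insert e₂ E') \ (insert e₁ t)) : Set ι)) x) then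
      ((if u ∈ openCluster (ends '' (↑(insert e₁ t) : Set ι)) x then (1 : ℝ) else 0) - (if u ∈ openCluster (ends '' (↑(insert e₁ (insert e₂ E') \ (insert e₁ t)) : Set ι)) x then (1 : ℝ) else 0)) *
        (g (openCluster (ends '' (↑(insert e₁ t) : Set ι)) x) - g (openCluster (ends '' (↑(insert e₁ (insert e₂ E') \ (insert e₁ t)) : Set ι)) x)) else 0) = fRB t := by
    intro t ht
    have htE : t ⊆ E' := Finset.mem_powerset.mp ht
    rw [cRB t htE, KR t htE, KB (E' \ t) (hsd t), hfRB]
    dsimp only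
    have hwall : (∀ z ∈ Z, z ∉ insert x (openCluster (ends '' (↑t : Set ι)) p) ∧ z ∉ insert x (openCluster (ends '' (↑(E' \ t) : Set ι)) q)) ↔
        (∀ z ∈ Z, z ∉ openCluster (ends '' (↑(t) : Set ι)) p ∧ z ∉ openCluster (ends '' (↑(E' \ t) : Set ι)) q) := by
      constructor
      · intro h z hz
        obtain ⟨ha, hb⟩ := h z hz
        rw [mIns _ z (hZx z hz)] at ha hb
        exact ⟨ha, hb⟩
      · intro h z hz
        obtain ⟨ha, hb⟩ := h z hz
        rw [mIns _ z (hZx z hz), mIns _ z (hZx z hz)]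
        exact ⟨ha, hb⟩
    by_cases hW : ∀ z ∈ Z, z ∉ openCluster (ends '' (↑(t) : Set ι)) p ∧ z ∉ openCluster (ends '' (↑(E' \ t) : Set ι)) q
    · rw [if_pos (hwall.mpr hW), if_pos hW, indT _ _ (mIns _ u hux), indT _ _ (mIns _ u hux)]
    · rw [if_neg (fun h => hW (hwall.mp h)), if_neg hW]
  -- sector RR (`s = insert e₁ (insert e₂ t)`)
  have sRR : ∀ t ∈ E'.powerset, (if (∀ z ∈ Z, z ∉ openCluster (ends '' (↑(insert e₁ (insert e₂ t)) : Set ι)) x ∧ z ∉ openCluster (ends '' (↑(insert e₁ (insert e₂ E') \ (insert e₁ (insert e₂ t))) : Set ι)) x) then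
      ((if u ∈ openCluster (ends '' (↑(insert e₁ (insert e₂ t)) : Set ι)) x then (1 : ℝ) else 0) - (if u ∈ openCluster (ends '' (↑(insert e₁ (insert e₂ E') \ (insert e₁ (insert e₂ t))) : Set ι)) x then (1 : ℝ) else 0)) *
        (g (openCluster (ends '' (↑(insert e₁ (insert e₂ t)) : Set ι)) x) - g (openCluster (ends '' (↑(insert e₁ (insert e₂ E') \ (insert e₁ (insert e₂ t))) : Set ι)) x)) else 0) = fRR t := by
    intro t ht
    have htE : t ⊆ E' := Finset.mem_powerset.mp ht
    rw [cRR t htE, KRR t htE, K0 (E' \ t) (hsd t), hfRR]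
    dsimp only
    have hwall : (∀ z ∈ Z, z ∉ insert x (openCluster (ends '' (↑t : Set ι)) p ∪ openCluster (ends '' (↑t : Set ι)) q) ∧ z ∉ ({x} : Set V)) ↔
        (∀ z ∈ Z, z ∉ openCluster (ends '' (↑(t) : Set ι)) p ∧ z ∉ openCluster (ends '' (↑(t) : Set ι)) q) := by
      constructor
      · intro h z hz
        have h1 := (h z hz).1
        rw [mIns _ z (hZx z hz), Set.mem_union] at h1
        exact ⟨fun h' => h1 (Or.inl h'), fun h' => h1 (Or.inr h')⟩
      · intro h z hz
        refine ⟨fun h' => ?_, m0 z (hZx z hz)⟩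
        rw [mIns _ z (hZx z hz), Set.mem_union] at h'
        exact h'.elim (h z hz).1 (h z hz).2
    by_cases hW : ∀ z ∈ Z, z ∉ openCluster (ends '' (↑(t) : Set ι)) p ∧ z ∉ openCluster (ends '' (↑(t) : Set ι)) q
    · have hu : (u ∈ insert x (openCluster (ends '' (↑t : Set ι)) p ∪ openCluster (ends '' (↑t : Set ι)) q)) ↔
          (u ∈ openCluster (ends '' (↑t : Set ι)) p ∨ u ∈ openCluster (ends '' (↑t : Set ι)) q) := by
        rw [mIns _ u hux, Set.mem_union]
      rw [if_pos (hwall.mpr hW), if_pos hW, ind0 _ (m0 u hux), indT _ _ hu]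
      ring
    · rw [if_neg (fun h => hW (hwall.mp h)), if_neg hW]
  rw [Finset.sum_congr rfl sBB, Finset.sum_congr rfl sBR, Finset.sum_congr rfl sRB, Finset.sum_congr rfl sRR]
  -- `t ↦ E' \ t` is an involution of `E'.powerset`
  have reflect : ∀ f : Finset ι → ℝ, ∑ t ∈ E'.powerset, f (E' \ t) = ∑ t ∈ E'.powerset, f t := by
    intro f
    refine Finset.sum_nbij' (fun t => E' \ t) (fun t => E' \ t) ?_ ?_ ?_ ?_ ?_
    · exact fun t _ => Finset.mem_powerset.mpr Finset.sdiff_subset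
    · exact fun t _ => Finset.mem_powerset.mpr Finset.sdiff_subset
    exacts [fun t ht => Finset.sdiff_sdiff_eq_self (Finset.mem_powerset.mp ht),
      fun t ht => Finset.sdiff_sdiff_eq_self (Finset.mem_powerset.mp ht), fun t _ => rfl]
  rw [reflect fRR, reflect fRB, Finset.sum_filter, Finset.sum_filter]
  have eRR : ∑ t ∈ E'.powerset, fRR t = ∑ t ∈ E'.powerset, (if (∀ z ∈ Z, z ∉ openCluster (ends '' (↑(t) : Set ι)) p ∧ z ∉ openCluster (ends '' (↑(t) : Set ι)) q) then
      (if (u ∈ openCluster (ends '' (↑(t) : Set ι)) p ∨ u ∈ openCluster (ends '' (↑(t) : Set ι)) q) then (1 : ℝ) else 0) *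
        (g (insert x (openCluster (ends '' (↑(t) : Set ι)) p ∪ openCluster (ends '' (↑(t) : Set ι)) q)) - g {x}) else 0) := rfl
  have eRB : ∑ t ∈ E'.powerset, fRB t = ∑ t ∈ E'.powerset, (if (∀ z ∈ Z, z ∉ openCluster (ends '' (↑(t) : Set ι)) p ∧ z ∉ openCluster (ends '' (↑(E' \ t) : Set ι)) q) then
      ((if u ∈ openCluster (ends '' (↑(t) : Set ι)) p then (1 : ℝ) else 0) - (if u ∈ openCluster (ends '' (↑(E' \ t) : Set ι)) q then (1 : ℝ) else 0)) *
        (g (insert x (openCluster (ends '' (↑(t) : Set ι)) p)) - g (insert x (openCluster (ends '' (↑(E' \ t) : Set ι)) q))) else 0) := rfl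
  rw [eRR, eRB]
  ring

end sums

end Coefficientwise

end Summit.CriticalPhenomena.PercolationContinuityZ3.Theorems
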